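import Mathlib

/-!
# Logarithmic clocks of a pinched enstrophy — real-analysis core
(crux stmt-NavierStokesRegularity-10493 `AdaptedFrequency.AdaptedFrequencyConverges`; rung of line
`birkhoff-recurrent-hull`, lands `--supports stmt-NavierStokesRegularity-10493`; consumed by
`…Theorems.AdaptedFrequencyAdaptedFrequencyConvergesLimitTwo`)

Pure real analysis about a positive differentiable function `H` on a window `(a, T)` and its
"frequency" `Λ(t) = (T − t) H′(t)/H(t)`:

* `not_frequency_ge_of_upperPinching` — if `(T − t)² H ≤ C₁` on `(a, T)` then `Λ ≥ 2 + δ` cannot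
  hold on all of `(a, T)` (`δ > 0`);
* `not_frequency_le_of_lowerPinching` — if `0 < c₀ ≤ (T − t)² H` on `(a, T)` then `Λ ≤ 2 − δ` cannot
  hold on all of `(a, T)`;
* `continuousOn_frequency` — `Λ` is continuous where `H` is `C²` and positive.

Mechanism: the logarithmic clock `σ ↦ log H(σ) + κ·log(T − σ)` has derivative `H′/H − κ/(T − σ)`
(`hasDerivAt_logClock`); for `κ = 2 ± δ` a one-sided bound on `Λ` makes it monotone
(`monotoneOn_of_deriv_nonneg` / `antitoneOn_of_deriv_nonpos`), which is incompatible with the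
boundedness of `log((T − t)² H) = log H + 2 log(T − t)` on the corresponding side as `t ↑ T`.
-/

noncomputable section

open Set

set_option linter.dupNamespace false

namespace Summit.NavierStokesRegularity.NavierStokesRegularity.Theorems.AdaptedFrequencyConverges.LimitTwo
/-! ### Real-analysis core: logarithmic clocks `log H + κ·log(T − ·)` -/

/-- Derivative of the logarithmic clock `σ ↦ log H σ + κ log (T − σ)` at an interior time of a
window `(a, T)` on which `H` is differentiable and positive:
`H′(τ)/H(τ) − κ/(T − τ)`. -/
theorem hasDerivAt_logClock {H : ℝ → ℝ} {a T κ : ℝ} (hH : DifferentiableOn ℝ H (Ioo a T))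
    (hpos : ∀ t ∈ Ioo a T, 0 < H t) {τ : ℝ} (hτ : τ ∈ Ioo a T) :
    HasDerivAt (fun σ => Real.log (H σ) + κ * Real.log (T - σ))
      (deriv H τ / H τ - κ / (T - τ)) τ := by
  have h1 : HasDerivAt H (deriv H τ) τ :=
    (hH.differentiableAt (Ioo_mem_nhds hτ.1 hτ.2)).hasDerivAt
  have h2 : HasDerivAt (fun σ => Real.log (H σ)) (deriv H τ / H τ) τ := h1.log (hpos τ hτ).ne'
  have h3 : HasDerivAt (fun σ : ℝ => T - σ) (-1) τ := (hasDerivAt_id' τ).const_sub T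
  have h4 : HasDerivAt (fun σ => Real.log (T - σ)) ((-1) / (T - τ)) τ :=
    h3.log (sub_pos.2 hτ.2).ne'
  have h5 := h2.add (h4.const_mul κ)
  exact h5.congr_deriv (by ring)

/-- `log ((T − t)² x) = log x + 2 log (T − t)` for `t < T`, `x > 0`. -/
theorem log_sq_mul {T t x : ℝ} (ht : t < T) (hx : 0 < x) :
    Real.log ((T - t) ^ 2 * x) = Real.log x + 2 * Real.log (T - t) := by
  have hTt : 0 < T - t := sub_pos.2 ht
  rw [Real.log_mul (pow_pos hTt 2).ne' hx.ne', Real.log_pow]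
  push_cast
  ring

/-- **No drift above `2`.** If `H` is differentiable and positive on `(a, T)`, UPPER-pinched there
(`(T − t)² H(t) ≤ C₁`), then its frequency `(T − t) H′/H` cannot stay `≥ 2 + δ` (`δ > 0`) on the
whole window: the clock `log H + (2 + δ) log (T − ·)` would be non-decreasing, forcing
`(T − t)² H(t) ≥ e^{K} (T − t)^{−δ} → ∞`. -/
theorem not_frequency_ge_of_upperPinching {H : ℝ → ℝ} {a T δ C₁ : ℝ} (haT : a < T) (hδ : 0 < δ)
    (hH : DifferentiableOn ℝ H (Ioo a T)) (hpos : ∀ t ∈ Ioo a T, 0 < H t)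
    (hup : ∀ t ∈ Ioo a T, (T - t) ^ 2 * H t ≤ C₁)
    (hΛ : ∀ t ∈ Ioo a T, 2 + δ ≤ (T - t) * deriv H t / H t) : False := by
  set φ : ℝ → ℝ := fun σ => Real.log (H σ) + (2 + δ) * Real.log (T - σ) with hφ
  have hφt : ∀ t, φ t = Real.log (H t) + (2 + δ) * Real.log (T - t) := fun t => rfl
  have hder : ∀ τ ∈ Ioo a T, HasDerivAt φ (deriv H τ / H τ - (2 + δ) / (T - τ)) τ :=
    fun τ hτ => hasDerivAt_logClock hH hpos hτ
  -- the clock is non-decreasing on `(a, T)`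
  have hmono : MonotoneOn φ (Ioo a T) := by
    refine monotoneOn_of_deriv_nonneg (convex_Ioo a T)
      (fun τ hτ => (hder τ hτ).continuousAt.continuousWithinAt) ?_ ?_
    · rw [interior_Ioo]
      exact fun τ hτ => (hder τ hτ).differentiableAt.differentiableWithinAt
    · rw [interior_Ioo]
      intro τ hτ
      rw [(hder τ hτ).deriv]
      have hTτ : 0 < T - τ := sub_pos.2 hτ.2
      have h := hΛ τ hτ
      rw [le_div_iff₀ (hpos τ hτ)] at h
      rw [sub_nonneg, div_le_div_iff₀ hTτ (hpos τ hτ)]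
      linarith [h, mul_comm (T - τ) (deriv H τ)]
  -- a reference time `t₁` and the positivity of `C₁`
  set t₁ : ℝ := (a + T) / 2 with ht₁
  have ht₁mem : t₁ ∈ Ioo a T := ⟨by rw [ht₁]; linarith, by rw [ht₁]; linarith⟩
  have hC₁ : 0 < C₁ :=
    lt_of_lt_of_le (mul_pos (pow_pos (sub_pos.2 ht₁mem.2) 2) (hpos t₁ ht₁mem)) (hup t₁ ht₁mem)
  -- a late time `t'` with `T − t' ≤ exp (K/δ) / 2`
  set K : ℝ := φ t₁ - Real.log C₁ with hK
  set η : ℝ := Real.exp (K / δ) / 2 with hη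
  have hηpos : 0 < η := by rw [hη]; positivity
  set t' : ℝ := max t₁ (T - η) with ht'
  have ht'1 : t₁ ≤ t' := le_max_left _ _
  have ht'T : t' < T := max_lt ht₁mem.2 (by linarith)
  have ht'mem : t' ∈ Ioo a T := ⟨lt_of_lt_of_le ht₁mem.1 ht'1, ht'T⟩
  have hTt' : 0 < T - t' := sub_pos.2 ht'T
  have hTt'le : T - t' ≤ η := by
    have : T - η ≤ t' := le_max_right _ _
    linarith
  -- monotonicity between `t₁` and `t'`
  have hφle : φ t₁ ≤ φ t' := hmono ht₁mem ht'mem ht'1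
  -- the upper pinching at `t'`
  have hφt' : φ t' ≤ Real.log C₁ + δ * Real.log (T - t') := by
    have h1 : Real.log ((T - t') ^ 2 * H t') ≤ Real.log C₁ :=
      Real.log_le_log (mul_pos (pow_pos hTt' 2) (hpos t' ht'mem)) (hup t' ht'mem)
    rw [log_sq_mul ht'T (hpos t' ht'mem)] at h1
    rw [hφt t']
    linarith
  -- hence `exp (K/δ) ≤ T − t' ≤ exp (K/δ) / 2`
  have hKle : K ≤ δ * Real.log (T - t') := by rw [hK]; linarith
  have hlog : K / δ ≤ Real.log (T - t') := by
    rw [div_le_iff₀ hδ]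
    linarith
  have hexp : Real.exp (K / δ) ≤ T - t' := by
    have := Real.exp_le_exp.2 hlog
    rwa [Real.exp_log hTt'] at this
  have : Real.exp (K / δ) ≤ Real.exp (K / δ) / 2 := by rw [hη] at hTt'le; exact hexp.trans hTt'le
  linarith [Real.exp_pos (K / δ)]

/-- **No drift below `2`.** If `H` is differentiable on `(a, T)` and LOWER-pinched there
(`0 < c₀ ≤ (T − t)² H(t)`), then its frequency `(T − t) H′/H` cannot stay `≤ 2 − δ` (`δ > 0`) on
the whole window: the clock `log H + (2 − δ) log (T − ·)` would be non-increasing, forcing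
`(T − t)² H(t) ≤ e^{K} (T − t)^{δ} → 0`. -/
theorem not_frequency_le_of_lowerPinching {H : ℝ → ℝ} {a T δ c₀ : ℝ} (haT : a < T) (hδ : 0 < δ)
    (hc₀ : 0 < c₀) (hH : DifferentiableOn ℝ H (Ioo a T))
    (hlow : ∀ t ∈ Ioo a T, c₀ ≤ (T - t) ^ 2 * H t)
    (hΛ : ∀ t ∈ Ioo a T, (T - t) * deriv H t / H t ≤ 2 - δ) : False := by
  -- positivity of `H` from the floor
  have hpos : ∀ t ∈ Ioo a T, 0 < H t := by
    intro t ht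
    have h1 := hlow t ht
    have h2 : 0 < (T - t) ^ 2 := pow_pos (sub_pos.2 ht.2) 2
    by_contra hle
    push Not at hle
    have : (T - t) ^ 2 * H t ≤ 0 := mul_nonpos_of_nonneg_of_nonpos h2.le hle
    linarith
  set ψ : ℝ → ℝ := fun σ => Real.log (H σ) + (2 - δ) * Real.log (T - σ) with hψ
  have hψt : ∀ t, ψ t = Real.log (H t) + (2 - δ) * Real.log (T - t) := fun t => rfl
  have hder : ∀ τ ∈ Ioo a T, HasDerivAt ψ (deriv H τ / H τ - (2 - δ) / (T - τ)) τ :=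
    fun τ hτ => hasDerivAt_logClock hH hpos hτ
  -- the clock is non-increasing on `(a, T)`
  have hanti : AntitoneOn ψ (Ioo a T) := by
    refine antitoneOn_of_deriv_nonpos (convex_Ioo a T)
      (fun τ hτ => (hder τ hτ).continuousAt.continuousWithinAt) ?_ ?_
    · rw [interior_Ioo]
      exact fun τ hτ => (hder τ hτ).differentiableAt.differentiableWithinAt
    · rw [interior_Ioo]
      intro τ hτ
      rw [(hder τ hτ).deriv]
      have hTτ : 0 < T - τ := sub_pos.2 hτ.2
      have h := hΛ τ hτ
      rw [div_le_iff₀ (hpos τ hτ)] at h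
      rw [sub_nonpos, div_le_div_iff₀ (hpos τ hτ) hTτ]
      linarith [h, mul_comm (T - τ) (deriv H τ)]
  -- a reference time `t₁`
  set t₁ : ℝ := (a + T) / 2 with ht₁
  have ht₁mem : t₁ ∈ Ioo a T := ⟨by rw [ht₁]; linarith, by rw [ht₁]; linarith⟩
  -- a late time `t'` with `T − t' ≤ exp (−K/δ) / 2`
  set K : ℝ := ψ t₁ - Real.log c₀ with hK
  set η : ℝ := Real.exp (-K / δ) / 2 with hη
  have hηpos : 0 < η := by rw [hη]; positivity
  set t' : ℝ := max t₁ (T - η) with ht'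
  have ht'1 : t₁ ≤ t' := le_max_left _ _
  have ht'T : t' < T := max_lt ht₁mem.2 (by linarith)
  have ht'mem : t' ∈ Ioo a T := ⟨lt_of_lt_of_le ht₁mem.1 ht'1, ht'T⟩
  have hTt' : 0 < T - t' := sub_pos.2 ht'T
  have hTt'le : T - t' ≤ η := by
    have : T - η ≤ t' := le_max_right _ _
    linarith
  -- antitonicity between `t₁` and `t'`
  have hψle : ψ t' ≤ ψ t₁ := hanti ht₁mem ht'mem ht'1
  -- the lower pinching at `t'`
  have hψt' : Real.log c₀ - δ * Real.log (T - t') ≤ ψ t' := by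
    have h1 : Real.log c₀ ≤ Real.log ((T - t') ^ 2 * H t') :=
      Real.log_le_log hc₀ (hlow t' ht'mem)
    rw [log_sq_mul ht'T (hpos t' ht'mem)] at h1
    rw [hψt t']
    linarith
  -- hence `exp (−K/δ) ≤ T − t' ≤ exp (−K/δ) / 2`
  have hKle : -K ≤ δ * Real.log (T - t') := by rw [hK]; linarith
  have hlog : -K / δ ≤ Real.log (T - t') := by
    rw [div_le_iff₀ hδ]
    linarith
  have hexp : Real.exp (-K / δ) ≤ T - t' := by
    have := Real.exp_le_exp.2 hlog
    rwa [Real.exp_log hTt'] at this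
  have : Real.exp (-K / δ) ≤ Real.exp (-K / δ) / 2 := by rw [hη] at hTt'le; exact hexp.trans hTt'le
  linarith [Real.exp_pos (-K / δ)]

/-- Continuity of the frequency `t ↦ (T − t) H′(t)/H(t)` on a window where `H` is `C²` and
positive. -/
theorem continuousOn_frequency {H : ℝ → ℝ} {a T : ℝ} (hC2 : ContDiffOn ℝ 2 H (Ioo a T))
    (hpos : ∀ t ∈ Ioo a T, 0 < H t) :
    ContinuousOn (fun t => (T - t) * deriv H t / H t) (Ioo a T) := by
  have h1 : ContinuousOn (deriv H) (Ioo a T) :=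
    hC2.continuousOn_deriv_of_isOpen isOpen_Ioo (by norm_num)
  have h2 : ContinuousOn H (Ioo a T) := hC2.continuousOn
  exact ((continuousOn_const.sub continuousOn_id).mul h1).div h2 fun t ht => (hpos t ht).ne'

end Summit.NavierStokesRegularity.NavierStokesRegularity.Theorems.AdaptedFrequencyConverges.LimitTwo

end
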